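import Literature.Probability.Percolation.CriticalContinuity
import Literature.Probability.Percolation.SharpnessDCTProofs
import Literature.Probability.Percolation.RSW
import Literature.Probability.Percolation.HalfSpacePinnedPairs
import Summits.CriticalPhenomena.PercolationContinuityZ3.Theorems.PercGamblersRuinBGNOffTheFloorStructure
import HarnessLib

/-!
# `BGNOffTheFloor` (stmt-CriticalPhenomena-7773), line `registered` (birth) — STUB 7 `stub_halfSpaceGluing`

Crux `Summit.CriticalPhenomena.PercolationContinuityZ3.Theses.PercGamblersRuin.BGNOffTheFloor`
(item stmt-CriticalPhenomena-7773), line `registered` (= `Cruxes/BGNOffTheFloor/Lines/birth.lean`,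
lead c4 reshape), stub `stub_halfSpaceGluing` (STUB 7 of the line's skeleton). Support file
(`--supports`), θ-blind, proved for every edge density `p`.

Notation of the docstrings: `G = {z : ℤ³ | -A < z₀}` (the region above the floor),
`E(A, M) = {ω | ∃ y, y₀ = M ∧ ω ∈ {0 ⟷ y in G}}` (the CLIMB EVENT to the level `M`),
`H(N) = {ω | ∃ y, y₀ = N ∧ ω ∈ {0 ⟷ y in {z | 0 ≤ z₀}}}` (the HALF-SPACE climb of `N` levels),
`e₀ = Pi.single 0 1` (the vertical unit vector).

Statement proved (ONE-SIDED PLANE GLUING, `HalfSpaceGluing.climb_mul_halfSpace_le`): for `0 ≤ A`,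
`1 ≤ L`, `P_p(E(A, L)) · P_p(H(N)) ≤ P_p(E(A, L + N))`; the registered stub is the instance
`p = p_c`, `A = a n`, `L = b n`, `N = n`.

Proof (Markov property at the first hit of the plane `{z₀ = L}`, without conditional expectations).
* (lattice surgery, `HalfSpaceGluing.exists_hit`) For a lattice configuration `ω ⊆ E(ℤ³)` in
  `E(A, L)`, the open path from `0` (level `0 ≤ L - 1`) to the level `L` leaves the lower half-space
  `{z₀ ≤ L - 1}` for the first time (`PathIn.exit`) through a lattice edge, necessarily the vertical
  edge `s(x, x + e₀)` from a site `x` of the level `L - 1`; its initial segment joins `0` to `x` inside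
  the slab `R = {-A < z₀ ≤ L - 1}`. Call this the HIT EVENT `K_x = {x₀ = L - 1} ∩ {0 ⟷ x in R} ∩
  {s(x, x + e₀) open}`, and let `F_x = K_x ∖ ⋃_{ι x' < ι x} K_{x'}` be the event that `x` is the
  MINIMAL hit site for a fixed injection `ι : ℤ³ → ℕ`; the `F_x` are pairwise disjoint and cover
  `E(A, L)` almost surely (`P_p` is carried by lattice configurations, `ae_subset_edgeSet`).
* (independence) `K_x`, hence `F_x`, is determined by the pairs NOT inside the upper half-space
  `T = {z | L ≤ z₀}` (`DCT16.determinedBy_openConnIn`: `R.sym2 ∩ T.sym2 = ∅`, and `x ∉ T`), while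
  the UP EVENT `U_x = {∃ y, y₀ = L + N ∧ x + e₀ ⟷ y in T}` is determined by `T.sym2`; both are
  measurable (`measurableSet_openConnIn_of_countable`), so `P_p(F_x ∩ U_x) = P_p(F_x) P_p(U_x)`
  (`bondPercolation_inter_of_disjoint`, the product structure of `P_p`).
* (translation) `P_p(U_x) = P_p(H(N))` by the shift `z ↦ z + (x + e₀)` (`bondPercolation_map_shift`,
  `GM.relabel_mem_openConnIn_iff`).
* (gluing) `F_x ∩ U_x ⊆ E(A, L + N)`: concatenate `0 ⟷ x in R ⊆ G`, the open edge `s(x, x + e₀)` and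
  `x + e₀ ⟷ y in T ⊆ G` (`openConnIn_mono`, `OffFloor.openConnIn_step`, `GM.openConnIn_trans`).
* (summation, `HalfSpaceGluing.measure_mul_le_of_glue`) `P(E(A,L)) P(H(N)) ≤ P(⋃ F_x) P(H(N)) =
  Σ_x P(F_x) P(H(N)) = Σ_x P(F_x ∩ U_x) = P(⋃ (F_x ∩ U_x)) ≤ P(E(A, L + N))` (`measure_iUnion` twice).

References: G. Grimmett, *Percolation*, 2nd ed. (1999), §1.3 (product measure), §2.2 (events
determined by the edges of a region); the one-sided ("trivially true") direction of G. Kozma,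
S. Nitzan, arXiv:2401.12397 (2024), Conjecture 1, for a separating plane.
-/

noncomputable section

namespace Summit.CriticalPhenomena.PercolationContinuityZ3.Theorems

open MeasureTheory Filter Literature.Probability.Percolation Literature.Probability.LatticeModels
open scoped ENNReal

namespace HalfSpaceGluing

/-! ### Abstract pieces: minimal-index events and the summation -/

/-- **Minimal index.** If `ω` lies in some `H x`, it lies in an `H x` with `ι x` minimal. [folklore] -/
theorem exists_minimal {α β : Type*} (ι : α → ℕ) {H : α → Set β} {ω : β} (h : ∃ x, ω ∈ H x) :
    ∃ x, ω ∈ H x ∧ ∀ x', ι x' < ι x → ω ∉ H x' := by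
  classical
  have hex : ∃ m, ∃ x, ι x = m ∧ ω ∈ H x := by
    obtain ⟨x, hx⟩ := h
    exact ⟨ι x, x, rfl, hx⟩
  obtain ⟨x, hxm, hx⟩ := Nat.find_spec hex
  refine ⟨x, hx, fun x' hlt hx' => ?_⟩
  rw [hxm] at hlt
  exact Nat.find_min hex hlt ⟨x', rfl, hx'⟩

/-- **The minimal-index events are pairwise disjoint** (`ι` injective). [folklore] -/
theorem pairwise_disjoint_minimal {α β : Type*} {ι : α → ℕ} (hι : Function.Injective ι)
    (H : α → Set β) :
    Pairwise (Function.onFun Disjoint fun x => {ω | ω ∈ H x ∧ ∀ x', ι x' < ι x → ω ∉ H x'}) := by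
  intro x₁ x₂ hne
  refine Set.disjoint_left.2 fun ω h₁ h₂ => ?_
  rcases lt_trichotomy (ι x₁) (ι x₂) with h | h | h
  · exact h₂.2 x₁ h h₁.1
  · exact hne (hι h)
  · exact h₁.2 x₂ h h₂.1

/-- **The minimal-index events are measurable** (countable index type, measurable `H x`). [folklore] -/
theorem measurableSet_minimal {α β : Type*} [MeasurableSpace β] [Countable α] (ι : α → ℕ)
    {H : α → Set β} (hH : ∀ x, MeasurableSet (H x)) (x : α) :
    MeasurableSet {ω | ω ∈ H x ∧ ∀ x', ι x' < ι x → ω ∉ H x'} := by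
  have hset : {ω | ω ∈ H x ∧ ∀ x', ι x' < ι x → ω ∉ H x'} =
      H x ∩ ⋂ x' ∈ {x' | ι x' < ι x}, (H x')ᶜ := by
    ext ω
    simp only [Set.mem_setOf_eq, Set.mem_inter_iff, Set.mem_iInter, Set.mem_compl_iff]
  rw [hset]
  exact (hH x).inter (MeasurableSet.biInter (Set.to_countable _) fun x' _ => (hH x').compl)

/-- **The minimal-index events are determined by whatever determines the `H x`.** [folklore] -/
theorem determinedBy_minimal {α γ : Type*} (ι : α → ℕ) {H : α → Set (Set γ)} {K : Set γ}
    (hH : ∀ x, DeterminedBy (H x) K) (x : α) :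
    DeterminedBy {ω | ω ∈ H x ∧ ∀ x', ι x' < ι x → ω ∉ H x'} K := by
  rw [determinedBy_iff]
  intro ω ω' h
  have key : ∀ x', ω ∈ H x' ↔ ω' ∈ H x' := fun x' => (determinedBy_iff _ _).1 (hH x') ω ω' h
  simp only [Set.mem_setOf_eq, key]

/-- Both sides of the product formula vanish when `F` is empty. [folklore] -/
theorem measure_inter_eq_mul_of_forall_notMem {β : Type*} [MeasurableSpace β] (μ : Measure β)
    {F U : Set β} (c : ℝ≥0∞) (hF : ∀ ω, ω ∉ F) : μ (F ∩ U) = μ F * c := by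
  rw [Set.eq_empty_of_forall_notMem hF, Set.empty_inter, measure_empty, zero_mul]

/-- **Abstract Markov gluing.** For a countable family of pairwise disjoint measurable events `F x`
and measurable events `U x` with `μ(F x ∩ U x) = μ(F x) · c`, if `E₁ ⊆ ⋃ F x` almost surely and
`F x ∩ U x ⊆ E₂` for all `x`, then `μ(E₁) · c ≤ μ(E₂)` (`measure_iUnion` twice). [folklore] -/
theorem measure_mul_le_of_glue {α β : Type*} [MeasurableSpace β] [Countable α] (μ : Measure β)
    {F U : α → Set β} {E₁ E₂ : Set β} {c : ℝ≥0∞}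
    (hF : Pairwise (Function.onFun Disjoint F)) (hFm : ∀ x, MeasurableSet (F x))
    (hUm : ∀ x, MeasurableSet (U x)) (hprod : ∀ x, μ (F x ∩ U x) = μ (F x) * c)
    (h₁ : ∀ᵐ ω ∂μ, ω ∈ E₁ → ω ∈ ⋃ x, F x) (h₂ : ∀ x, F x ∩ U x ⊆ E₂) :
    μ E₁ * c ≤ μ E₂ := by
  have hdisj : Pairwise (Function.onFun Disjoint fun x => F x ∩ U x) := fun x y hxy =>
    (hF hxy).mono Set.inter_subset_left Set.inter_subset_left
  calc μ E₁ * c ≤ μ (⋃ x, F x) * c := mul_le_mul' (measure_mono_ae h₁) le_rfl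
    _ = (∑' x, μ (F x)) * c := by rw [measure_iUnion hF hFm]
    _ = ∑' x, μ (F x ∩ U x) := by
        rw [← ENNReal.tsum_mul_right]
        exact tsum_congr fun x => (hprod x).symm
    _ = μ (⋃ x, F x ∩ U x) := (measure_iUnion hdisj fun x => (hFm x).inter (hUm x)).symm
    _ ≤ μ E₂ := measure_mono (Set.iUnion_subset h₂)

/-! ### Lattice surgery: the first hit of the plane `{z₀ = L}` -/

/-- **The hit site.** For a lattice configuration `ω ⊆ E(ℤ³)` in the climb event `E(A, L)`, `L ≥ 1`,
there is a site `x` of the level `L - 1` joined to `0` inside the slab `{-A < z₀ ≤ L - 1}` whose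
vertical edge `s(x, x + e₀)` is open: the first exit (`PathIn.exit`) of the open path from the lower
half-space `{z₀ ≤ L - 1}` is through a lattice edge (`ω ⊆ E(ℤ³)`), which raises the height by one,
hence is vertical (`zdGraph_adj_iff`). [folklore] -/
theorem exists_hit {A L : ℤ} (hL : 1 ≤ L) {ω : BondConfig (Site 3)} (hω : ω ⊆ (zdGraph 3).edgeSet)
    (h : ω ∈ {ω | ∃ y : Site 3, y 0 = L ∧ ω ∈ openConnIn {z : Site 3 | -A < z 0} 0 y}) :
    ∃ x : Site 3, ω ∈ {ω : BondConfig (Site 3) | x 0 = L - 1 ∧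
      ω ∈ openConnIn {z : Site 3 | -A < z 0 ∧ z 0 ≤ L - 1} 0 x ∧ s(x, x + Pi.single 0 1) ∈ ω} := by
  obtain ⟨y, hy, hconn⟩ := h
  have hpath := DCT16.pathIn_of_mem_openConnIn hconn
  obtain ⟨u, v, hu, hv, -, hadj, hpre⟩ := hpath.exit (R := {z : Site 3 | z 0 ≤ L - 1})
    (show (0 : Site 3) ∈ {z : Site 3 | z 0 ≤ L - 1} by
      simp only [Set.mem_setOf_eq, Pi.zero_apply]; omega)
    (show y ∉ {z : Site 3 | z 0 ≤ L - 1} by simp only [Set.mem_setOf_eq, not_le]; omega)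
  simp only [Set.mem_setOf_eq, not_le] at hu hv
  have hG : (zdGraph 3).Adj u v := DCT16.adj_of_openGraph_adj hω hadj
  have hle := (zdGraph_adj_apply_le hG 0).1
  have hopen : s(u, v) ∈ ω := ((openGraph_adj ω u v).1 hadj).1
  have hslab : ω ∈ openConnIn {z : Site 3 | -A < z 0 ∧ z 0 ≤ L - 1} 0 u := by
    refine openConnIn_mono ?_ 0 u (DCT16.mem_openConnIn_of_pathIn hpre)
    exact fun z hz => ⟨hz.2, hz.1⟩
  obtain ⟨i, hi | hi⟩ := (zdGraph_adj_iff u v).1 hG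
  · have h0 := congrFun hi 0
    simp only [Pi.add_apply, Pi.single_apply] at h0
    split_ifs at h0 with hi0
    · subst hi0
      subst hi
      exact ⟨u, by omega, hslab, hopen⟩
    · omega
  · have h0 := congrFun hi 0
    simp only [Pi.add_apply, Pi.single_apply] at h0
    split_ifs at h0 <;> omega

/-- **Gluing.** `K_x ∩ U_x ⊆ E(A, M)`: `0 ⟷ x` inside the slab `⊆ G`, the open vertical edge
`s(x, x + e₀)` (`x + e₀ ∈ G`), then `x + e₀ ⟷ y` inside `{L ≤ z₀} ⊆ G` (`-A < L`). [folklore] -/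
theorem glue_subset {A L M : ℤ} (hAL : -A < L) {x : Site 3} {ω : BondConfig (Site 3)}
    (hx : x 0 = L - 1) (h1 : ω ∈ openConnIn {z : Site 3 | -A < z 0 ∧ z 0 ≤ L - 1} 0 x)
    (he : s(x, x + Pi.single 0 1) ∈ ω)
    (h2 : ω ∈ {ω : BondConfig (Site 3) | ∃ y : Site 3, y 0 = M ∧
      ω ∈ openConnIn {z : Site 3 | L ≤ z 0} (x + Pi.single 0 1) y}) :
    ω ∈ {ω : BondConfig (Site 3) | ∃ y : Site 3, y 0 = M ∧
      ω ∈ openConnIn {z : Site 3 | -A < z 0} 0 y} := by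
  obtain ⟨y, hy, h2⟩ := h2
  refine ⟨y, hy, ?_⟩
  have hx1 : (x + Pi.single 0 1 : Site 3) 0 = L := by
    simp only [Pi.add_apply, Pi.single_eq_same]; omega
  have step1 : ω ∈ openConnIn {z : Site 3 | -A < z 0} 0 x :=
    openConnIn_mono (fun z hz => hz.1) 0 x h1
  have step2 : ω ∈ openConnIn {z : Site 3 | -A < z 0} 0 (x + Pi.single 0 1) := by
    refine OffFloor.openConnIn_step step1 ?_ he ?_
    · simp only [Set.mem_setOf_eq, hx1]; omega
    · intro h
      have := congrFun h 0
      simp only [Pi.add_apply, Pi.single_eq_same] at this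
      omega
  have step3 : ω ∈ openConnIn {z : Site 3 | -A < z 0} (x + Pi.single 0 1) y :=
    openConnIn_mono (fun z hz => by simp only [Set.mem_setOf_eq] at hz ⊢; omega) _ _ h2
  exact GM.openConnIn_trans step2 step3

/-! ### Finite dependence and measurability of the hit and up events -/

/-- Pairs inside the slab `{-A < z₀ ≤ L - 1}` are not pairs inside the upper half-space
`{L ≤ z₀}`. [folklore] -/
theorem sym2_slab_subset_compl (A L : ℤ) :
    {z : Site 3 | -A < z 0 ∧ z 0 ≤ L - 1}.sym2 ⊆ ({z : Site 3 | L ≤ z 0}.sym2)ᶜ := by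
  intro e
  induction e using Sym2.ind with
  | h a b =>
    simp only [Set.mk_mem_sym2_iff, Set.mem_setOf_eq, Set.mem_compl_iff, not_and, not_le]
    omega

/-- **The hit event `K_x` is determined by the pairs not inside `{L ≤ z₀}`**: `{0 ⟷ x in R}` by the
pairs inside the slab `R` (`DCT16.determinedBy_openConnIn`), and the vertical edge `s(x, x + e₀)`
has its lower endpoint `x` below the plane. [folklore] -/
theorem determinedBy_hit (A L : ℤ) (x : Site 3) :
    DeterminedBy {ω : BondConfig (Site 3) | x 0 = L - 1 ∧
        ω ∈ openConnIn {z : Site 3 | -A < z 0 ∧ z 0 ≤ L - 1} 0 x ∧ s(x, x + Pi.single 0 1) ∈ ω}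
      ({z : Site 3 | L ≤ z 0}.sym2)ᶜ := by
  rw [determinedBy_iff]
  intro ω ω' h
  have hconn := (determinedBy_iff _ _).1
    (DCT16.determinedBy_openConnIn {z : Site 3 | -A < z 0 ∧ z 0 ≤ L - 1} 0 x
      (sym2_slab_subset_compl A L)) ω ω' h
  by_cases hx : x 0 = L - 1
  · have hedge : s(x, x + Pi.single 0 1) ∈ ({z : Site 3 | L ≤ z 0}.sym2)ᶜ := by
      simp only [Set.mem_compl_iff, Set.mk_mem_sym2_iff, Set.mem_setOf_eq, not_and]
      intro h1
      omega
    have he : s(x, x + Pi.single 0 1) ∈ ω ↔ s(x, x + Pi.single 0 1) ∈ ω' :=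
      ⟨fun h1 => (((Set.ext_iff.1 h) _).1 ⟨h1, hedge⟩).1,
        fun h1 => (((Set.ext_iff.1 h) _).2 ⟨h1, hedge⟩).1⟩
    simp only [Set.mem_setOf_eq, hconn, he]
  · simp only [Set.mem_setOf_eq, hx, false_and]

/-- **The up event `U_x` is determined by the pairs inside `{L ≤ z₀}`** (`DCT16.determinedBy_openConnIn`
for each target site `y`). [folklore] -/
theorem determinedBy_up (L M : ℤ) (v : Site 3) :
    DeterminedBy {ω : BondConfig (Site 3) | ∃ y : Site 3, y 0 = M ∧
        ω ∈ openConnIn {z : Site 3 | L ≤ z 0} v y} ({z : Site 3 | L ≤ z 0}.sym2) := by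
  rw [determinedBy_iff]
  intro ω ω' h
  have key : ∀ y : Site 3, ω ∈ openConnIn {z : Site 3 | L ≤ z 0} v y ↔
      ω' ∈ openConnIn {z : Site 3 | L ≤ z 0} v y := fun y =>
    (determinedBy_iff _ _).1 (DCT16.determinedBy_openConnIn _ v y subset_rfl) ω ω' h
  simp only [Set.mem_setOf_eq, key]

/-- The hit event `K_x` is measurable (`measurableSet_openConnIn_of_countable`, one-edge event).
[folklore] -/
theorem measurableSet_hit (A L : ℤ) (x : Site 3) :
    MeasurableSet {ω : BondConfig (Site 3) | x 0 = L - 1 ∧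
      ω ∈ openConnIn {z : Site 3 | -A < z 0 ∧ z 0 ≤ L - 1} 0 x ∧ s(x, x + Pi.single 0 1) ∈ ω} :=
  (MeasurableSet.const _).inter
    ((measurableSet_openConnIn_of_countable _ _ _).inter (measurableSet_mem _))

/-- A climb event `{∃ y, y₀ = M ∧ v ⟷ y in S}` is measurable (countable union over the target
site). [folklore] -/
theorem measurableSet_climb (S : Set (Site 3)) (v : Site 3) (M : ℤ) :
    MeasurableSet {ω : BondConfig (Site 3) | ∃ y : Site 3, y 0 = M ∧ ω ∈ openConnIn S v y} := by
  have hset : {ω : BondConfig (Site 3) | ∃ y : Site 3, y 0 = M ∧ ω ∈ openConnIn S v y} =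
      ⋃ y : Site 3, {ω : BondConfig (Site 3) | y 0 = M} ∩ openConnIn S v y := by
    ext ω
    simp only [Set.mem_setOf_eq, Set.mem_iUnion, Set.mem_inter_iff]
  rw [hset]
  exact MeasurableSet.iUnion fun y =>
    (MeasurableSet.const _).inter (measurableSet_openConnIn_of_countable _ _ _)

/-! ### Translation: `P(U_x) = P(H(N))` -/

/-- **Translation invariance of the up event.** For `x` on the level `L - 1`, the shift by
`x + e₀` (`bondPercolation_map_shift`) carries `{∃ y, y₀ = L + N ∧ x + e₀ ⟷ y in {L ≤ z₀}}` to the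
half-space climb `H(N) = {∃ y, y₀ = N ∧ 0 ⟷ y in {0 ≤ z₀}}` (`GM.relabel_mem_openConnIn_iff`).
[folklore] -/
theorem measure_up_eq (p : unitInterval) (L N : ℤ) {x : Site 3} (hx : x 0 = L - 1) :
    bondPercolation (zdGraph 3) p {ω : BondConfig (Site 3) | ∃ y : Site 3, y 0 = L + N ∧
        ω ∈ openConnIn {z : Site 3 | L ≤ z 0} (x + Pi.single 0 1) y} =
      bondPercolation (zdGraph 3) p {ω : BondConfig (Site 3) | ∃ y : Site 3, y 0 = N ∧
        ω ∈ openConnIn {z : Site 3 | 0 ≤ z 0} 0 y} := by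
  set v : Site 3 := x + Pi.single 0 1 with hv
  have hv0 : v 0 = L := by
    simp only [hv, Pi.add_apply, Pi.single_eq_same]; omega
  have hpre : (Site.shift v) ⁻¹' {z : Site 3 | L ≤ z 0} = {z : Site 3 | 0 ≤ z 0} := by
    ext w
    simp only [Set.mem_preimage, Set.mem_setOf_eq, Site.shift_apply, Pi.add_apply, hv0]
    omega
  have key : BondConfig.relabel (sym2Equiv (Site.shift v)) ⁻¹'
      {ω : BondConfig (Site 3) | ∃ y : Site 3, y 0 = L + N ∧
        ω ∈ openConnIn {z : Site 3 | L ≤ z 0} v y} =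
      {ω : BondConfig (Site 3) | ∃ y : Site 3, y 0 = N ∧
        ω ∈ openConnIn {z : Site 3 | 0 ≤ z 0} 0 y} := by
    ext ω
    simp only [Set.mem_preimage, Set.mem_setOf_eq]
    constructor
    · rintro ⟨y, hy, hconn⟩
      refine ⟨y - v, by simp only [Pi.sub_apply, hy, hv0]; omega, ?_⟩
      have h1 : BondConfig.relabel (sym2Equiv (Site.shift v)) ω ∈
          openConnIn {z : Site 3 | L ≤ z 0} (Site.shift v 0) (Site.shift v (y - v)) := by
        rwa [Site.shift_apply, Site.shift_apply, zero_add, sub_add_cancel]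
      rwa [GM.relabel_mem_openConnIn_iff, hpre] at h1
    · rintro ⟨y, hy, hconn⟩
      refine ⟨y + v, by simp only [Pi.add_apply, hy, hv0]; omega, ?_⟩
      rw [← hpre, ← GM.relabel_mem_openConnIn_iff (Site.shift v)] at hconn
      rwa [Site.shift_apply, Site.shift_apply, zero_add] at hconn
  calc bondPercolation (zdGraph 3) p {ω : BondConfig (Site 3) | ∃ y : Site 3, y 0 = L + N ∧
          ω ∈ openConnIn {z : Site 3 | L ≤ z 0} v y}
        = ((bondPercolation (zdGraph 3) p).map (BondConfig.relabel (sym2Equiv (Site.shift v))))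
            {ω : BondConfig (Site 3) | ∃ y : Site 3, y 0 = L + N ∧
              ω ∈ openConnIn {z : Site 3 | L ≤ z 0} v y} := by
          rw [bondPercolation_map_shift]
    _ = bondPercolation (zdGraph 3) p (BondConfig.relabel (sym2Equiv (Site.shift v)) ⁻¹'
            {ω : BondConfig (Site 3) | ∃ y : Site 3, y 0 = L + N ∧
              ω ∈ openConnIn {z : Site 3 | L ≤ z 0} v y}) := MeasurableEquiv.map_apply _ _
    _ = _ := by rw [key]

/-! ### The product formula and the assembly -/

/-- **Markov property at the first hit, one term.** `P(F_x ∩ U_x) = P(F_x) · P(H(N))`: for `x` on the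
level `L - 1`, `F_x` is determined by the pairs not inside `{L ≤ z₀}` and `U_x` by the pairs inside
it (`bondPercolation_inter_of_disjoint`), and `P(U_x) = P(H(N))` (`measure_up_eq`); for other `x`,
`F_x = ∅`. [folklore] -/
theorem measure_minimal_inter_up (p : unitInterval) (ι : Site 3 → ℕ) (A L N : ℤ) (x : Site 3) :
    bondPercolation (zdGraph 3) p
        ({ω : BondConfig (Site 3) |
          ω ∈ {ω : BondConfig (Site 3) | x 0 = L - 1 ∧
            ω ∈ openConnIn {z : Site 3 | -A < z 0 ∧ z 0 ≤ L - 1} 0 x ∧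
              s(x, x + Pi.single 0 1) ∈ ω} ∧
          ∀ x' : Site 3, ι x' < ι x → ω ∉ {ω : BondConfig (Site 3) | x' 0 = L - 1 ∧
            ω ∈ openConnIn {z : Site 3 | -A < z 0 ∧ z 0 ≤ L - 1} 0 x' ∧
              s(x', x' + Pi.single 0 1) ∈ ω}} ∩
        {ω : BondConfig (Site 3) | ∃ y : Site 3, y 0 = L + N ∧
          ω ∈ openConnIn {z : Site 3 | L ≤ z 0} (x + Pi.single 0 1) y}) =
      bondPercolation (zdGraph 3) p
        {ω : BondConfig (Site 3) |
          ω ∈ {ω : BondConfig (Site 3) | x 0 = L - 1 ∧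
            ω ∈ openConnIn {z : Site 3 | -A < z 0 ∧ z 0 ≤ L - 1} 0 x ∧
              s(x, x + Pi.single 0 1) ∈ ω} ∧
          ∀ x' : Site 3, ι x' < ι x → ω ∉ {ω : BondConfig (Site 3) | x' 0 = L - 1 ∧
            ω ∈ openConnIn {z : Site 3 | -A < z 0 ∧ z 0 ≤ L - 1} 0 x' ∧
              s(x', x' + Pi.single 0 1) ∈ ω}} *
      bondPercolation (zdGraph 3) p {ω : BondConfig (Site 3) | ∃ y : Site 3, y 0 = N ∧
        ω ∈ openConnIn {z : Site 3 | 0 ≤ z 0} 0 y} := by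
  by_cases hx : x 0 = L - 1
  · rw [← measure_up_eq p L N hx]
    exact bondPercolation_inter_of_disjoint (zdGraph 3) p disjoint_compl_left
      (determinedBy_minimal ι (fun x' => determinedBy_hit A L x') x)
      (determinedBy_up L (L + N) _)
      (measurableSet_minimal ι (fun x' => measurableSet_hit A L x') x)
      (measurableSet_climb _ _ _)
  · exact measure_inter_eq_mul_of_forall_notMem _ _ fun ω hω => hx hω.1.1

/-- **One-sided plane gluing, general form.** For every edge density `p`, floor depth `A ≥ 0`,
plane height `L ≥ 1` and `N`: `P_p(E(A, L)) · P_p(H(N)) ≤ P_p(E(A, L + N))` — the Markov property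
at the first hit of the plane `{z₀ = L}` (`exists_hit`, `measure_minimal_inter_up`, `glue_subset`,
summed by `measure_mul_le_of_glue`). [folklore] -/
theorem climb_mul_halfSpace_le (p : unitInterval) {A L N : ℤ} (hA : 0 ≤ A) (hL : 1 ≤ L) :
    (bondPercolation (zdGraph 3) p).real
        {ω | ∃ y : Site 3, y 0 = L ∧ ω ∈ openConnIn {z : Site 3 | -A < z 0} 0 y} *
      (bondPercolation (zdGraph 3) p).real
        {ω | ∃ y : Site 3, y 0 = N ∧ ω ∈ openConnIn {z : Site 3 | 0 ≤ z 0} 0 y} ≤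
    (bondPercolation (zdGraph 3) p).real
        {ω | ∃ y : Site 3, y 0 = L + N ∧ ω ∈ openConnIn {z : Site 3 | -A < z 0} 0 y} := by
  obtain ⟨ι, hι⟩ := Countable.exists_injective_nat (Site 3)
  simp only [measureReal_def]
  rw [← ENNReal.toReal_mul]
  refine ENNReal.toReal_mono (measure_ne_top _ _) ?_
  refine measure_mul_le_of_glue (bondPercolation (zdGraph 3) p)
    (pairwise_disjoint_minimal hι _)
    (fun x => measurableSet_minimal ι (fun x' => measurableSet_hit A L x') x)
    (fun x => measurableSet_climb _ _ _)
    (fun x => measure_minimal_inter_up p ι A L N x) ?_ ?_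
  · filter_upwards [ae_subset_edgeSet (zdGraph 3) p] with ω hω hE
    obtain ⟨x, hx⟩ := exists_minimal ι (exists_hit hL hω hE)
    exact Set.mem_iUnion.2 ⟨x, hx⟩
  · rintro x ω ⟨⟨⟨hx, h1, he⟩, -⟩, h2⟩
    exact glue_subset (by omega) hx h1 he h2

end HalfSpaceGluing

open HalfSpaceGluing in
/-- **STUB 7 of line `registered` (birth) of `BGNOffTheFloor` (`halfSpaceGluing`), registered
signature verbatim.** One-sided plane gluing at criticality: for `1 ≤ a < b`, `n ≥ 1`,
`e_n(a,b) · f(1,n) ≤ e_n(a,b+1)`, where `e_n(a,b) = P_{p_c}(0 ⟷ {z₀ = b n} in {z₀ > -a n})` and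
`f(1,n) = P_{p_c}(0 ⟷ {z₀ = n} in {z₀ ≥ 0})` is the half-space climb — the instance `A = a n`,
`L = b n`, `N = n` of `HalfSpaceGluing.climb_mul_halfSpace_le` (Markov property at the first hit
of the plane `{z₀ = b n}`). [folklore] -/
theorem stub_halfSpaceGluing : ∀ a b n : ℕ, 1 ≤ a → a < b → 1 ≤ n →
    (bondPercolation (zdGraph 3) (criticalProbI 3)).real
        {ω | ∃ y : Site 3, y 0 = ((b * n : ℕ) : ℤ) ∧
          ω ∈ openConnIn {z : Site 3 | -((a * n : ℕ) : ℤ) < z 0} 0 y} *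
      (bondPercolation (zdGraph 3) (criticalProbI 3)).real
        {ω | ∃ y : Site 3, y 0 = ((n : ℕ) : ℤ) ∧
          ω ∈ openConnIn {z : Site 3 | 0 ≤ z 0} 0 y} ≤
    (bondPercolation (zdGraph 3) (criticalProbI 3)).real
        {ω | ∃ y : Site 3, y 0 = (((b + 1) * n : ℕ) : ℤ) ∧
          ω ∈ openConnIn {z : Site 3 | -((a * n : ℕ) : ℤ) < z 0} 0 y} := by
  intro a b n _ hab hn
  have hbn : 1 * 1 ≤ b * n := Nat.mul_le_mul (by omega) hn
  have hL : (1 : ℤ) ≤ ((b * n : ℕ) : ℤ) := by exact_mod_cast hbn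
  have hM : (((b + 1) * n : ℕ) : ℤ) = ((b * n : ℕ) : ℤ) + ((n : ℕ) : ℤ) := by push_cast; ring
  rw [hM]
  exact climb_mul_halfSpace_le (criticalProbI 3) (A := ((a * n : ℕ) : ℤ)) (by positivity) hL

end Summit.CriticalPhenomena.PercolationContinuityZ3.Theorems

end
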